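import Summits.QuantumFields.BalabanUV.Beta.D1BFx.PackedCoframePair
import Summits.QuantumFields.BalabanUV.Beta.D1BFx.PackedCoframePairLimit
import Summits.QuantumFields.BalabanUV.Beta.D1BFx.PackedNSideDictionary

/-!
# BetaPertH road «BF-x» — (D) «N-DICT» PART II: the SECOND-ORDER N-side letters `hJN″ hWN hlimWN` of PART 4

STATUS: [folklore] bookkeeping for the road's (A1)-PACKED identity (BINDER row D1, slot (K), chain step (I)); NOT an estimate of Bałaban's, NOT a
discharge of any root-level binder.  Provenance: reconstruction; the manuscript(s) under audit are NOT citable.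

WHAT.  PART 4 (`PackedLiteralCombineN.hessKer_transfer_road_cov_packed_literal_N`, owner d1-p2) displays the N SECOND ORDER as
`(𝒲N 𝒲N∞) {CN δWN} (hWN : ∀ k, BiLoc (𝒲N k μ 0 ν z) ((m+1)•0) ((m+1)•z) CN δWN) (hδWN : 0 < δWN) (hlimWN) (hJN″ : ∀ k, kkt (kₛₜ k + tgramMix …) (qₛₜ k)
= blocksHat (p k) (sortK (m+1) (arr s_k (𝒲N k μ 0 ν z))))`.  This file gives the EXPLICIT family and the three letters:
* §1 [our objects] **`W2N m a r S₂ s μ y ν y′ := twistR 𝒲lit_s + embFF (cofPair s (m+1) a (colH G₀ (m+1) μ y) (colH G₀ (m+1) ν y′))`** (the re-signed literal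
  second table of PART 4's pins `hkₛₜ hqₛₜ` plus the embedded packed twisted co-frame table of P3b) and its `s`-free limit **`W2NInf`**; `kkt_add_eq`.
* §2 [folklore] **`kkt_packed_eq_blocksHat_W2N`** = PART 4's `hJN″` per torus, in PART 4's binder types (pins `hT• hA• hkₛₜ hqₛₜ`, responses `hrS hrT`):
  `packed_second_kkt_sgn` (PART 1) + FILE 0 `blocksHat_sortK_twistR` + P3c `tgramMix_packed_eq_blocksHat`.
* §3 [folklore] **`biLoc_W2N_uniform`** (`hWN`, `hδWN`: gan24-leaf-05 `biLoc_sliceSum_images_colH` + P4a) and **`tendsto_W2N`** (`hlimWN`: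
  `tendsto_sliceSum_images_colH` + P4b), both at ARBITRARY base sites `(μ, y)`, `(ν, z)` (PART 4 instantiates `y := 0`); and the `Loc` letter of the
  limit family **`loc_W2NInf`** (PART 8 `PackedRoadK6cSkeleton`'s socket `hWNloc`: the uniform bound is a closed condition along `p k := k + 1`).
Unit `b2b-balaban-beta-d1-formalise-leaf-03` (gen 23; v1.2 gen 24: §3 at general base sites + `loc_W2NInf`); road owner `b2b-balaban-beta-d1-p2`
(INTENT-6, journal l.41005).
-/

noncomputable section

namespace Summit.QuantumFields.BalabanUV.Beta.D1BFx.PackedNSidePair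

open Matrix Filter Topology
open scoped BigOperators
open Literature.Probability.LatticeModels (TorusSite)
open Literature.MathematicalPhysics.QuantumFieldTheory.Balaban1983to89
open Literature.MathematicalPhysics.QuantumFieldTheory.Balaban1983to89.Beta
open Literature.MathematicalPhysics.QuantumFieldTheory.Balaban1983to89.Beta.Composition (kkt)
open B12Sec2to5 (l1 l1_nonneg)
open ExpKernelCalculus (MKer BiLoc Decays Zl)
open AffineAveraging (box toSite)
open OneStepResolventKernel (Fib wsum)
open OneStepKernelFamily (KInvStep colH)
open KernelWard (biLoc_add biLoc_recentre)
open Summit.QuantumFields.BalabanUV.Beta.AxialDressingRooted (coDressKBmAt decays_coDressKBmAt_KInvStep)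
open Summit.QuantumFields.BalabanUV.Beta.D1BFx.FibredPeriodisation (periodiseF)
open Summit.QuantumFields.BalabanUV.Beta.D1BFx.SortedKernels (blocksHat fTL fBL)
open Summit.QuantumFields.BalabanUV.Beta.D1BFx.SortedPack (sortK)
open Summit.QuantumFields.BalabanUV.Beta.D1BFx.SortedReblocking (torusBlockEquiv)
open Summit.QuantumFields.BalabanUV.Beta.D1BFx.SortedEmbedding (e₁)
open Summit.QuantumFields.BalabanUV.Beta.D1BFx.PeriodicArrays (arr toF)
open Summit.QuantumFields.BalabanUV.Beta.D1BFx.GramWeightColourLift (tgramMix)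
open Summit.QuantumFields.BalabanUV.Beta.D1BFx.TorusCombKKT (I J CombRows tauT Khat Qhat)
open Summit.QuantumFields.BalabanUV.Beta.D1BFx.TorusGaugeBasisMatrix (Nhat)
open Summit.QuantumFields.BalabanUV.Beta.D1BFx.TorusCoframeJets (Tjet₀ Tjet₁ Tjet₁₁ Ajet₀ Ajet₁ Ajet₁₁)
open Summit.QuantumFields.BalabanUV.Beta.D1BFx.TorusBondArrays (dB dB_pos)
open Summit.QuantumFields.BalabanUV.Beta.D1BFx.GhostStencil (l1_zero)
open Summit.QuantumFields.BalabanUV.Beta.D1BFx.PeriodicArrayWrapColH (colH_weight biLoc_sliceSum_images_colH tendsto_sliceSum_images_colH)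
open Summit.QuantumFields.BalabanUV.Beta.D1BFx.PackedDictionaryLetters (packed_second_kkt_sgn)
open Summit.QuantumFields.BalabanUV.Beta.D1BFx.PackedBlockGlue (response_siteOf_eq_tsum_colH)
open Summit.QuantumFields.BalabanUV.Beta.D1BFx.PackedSortedBridges (embFF twistR biLoc_embFF biLoc_twistR arr_twistR blocksHat_sortK_twistR mul_sgn_eq_iff
  tendsto_twistR_apply embFF_inl_inl embFF_inl_inr embFF_inr_inl embFF_inr_inr)
open Summit.QuantumFields.BalabanUV.Beta.D1BFx.PackedNSideDictionary (blocksHat_sortK_arr_add)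
open Summit.QuantumFields.BalabanUV.Beta.D1BFx.PackedCoframePairLoc (cofPair biLoc_cofPair_uniform)
open Summit.QuantumFields.BalabanUV.Beta.D1BFx.PackedCoframePairLimit (cofPairInf tendsto_cofPair)
open Summit.QuantumFields.BalabanUV.Beta.D1BFx.PackedCoframePair (tgramMix_packed_eq_blocksHat)

/-! ## §1 The explicit N-side second table -/

section Family

variable (m : ℕ) (a : ℝ) (r : Fin (3 + 1) → ℕ) (S₂ : Fin 4 → (Fin 4 → ℤ) → Fin 4 → (Fin 4 → ℤ) → MKer 4 (Fib 3))

/-- [our object] **THE LITERAL's PACKED SECOND TABLE** on the torus of period `s` (PART 4's pins `hkₛₜ hqₛₜ`): the slice-summed, second-weight-periodised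
superposition of the pair stencils `S₂` at the road's p-free weights `colH G₀ (m+1)`. A definition; asserts nothing. -/
def W2lit (s : ℕ) (μ : Fin 4) (y : Fin 4 → ℤ) (ν : Fin 4) (y' : Fin 4 → ℤ) : MKer 4 (Fib 3) := fun x z c b =>
  ∑ κ' : Fin 4, ∑ κ'' : Fin 4,
    wsum (colH (coDressKBmAt (toSite r) (m + 1) (KInvStep (d := 3) (m + 1) 0)) (m + 1) μ y κ')
      (fun u => wsum (fun u'' => ∑' t : Fin 4 → ℤ,
        colH (coDressKBmAt (toSite r) (m + 1) (KInvStep (d := 3) (m + 1) 0)) (m + 1) ν y' κ'' (imageShift s u'' t)) (S₂ κ' u κ'')) x z c b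

/-- [our object] Its `s`-free limit (plain second weight). A definition. -/
def W2litInf (μ : Fin 4) (y : Fin 4 → ℤ) (ν : Fin 4) (y' : Fin 4 → ℤ) : MKer 4 (Fib 3) := fun x z c b =>
  ∑ κ' : Fin 4, ∑ κ'' : Fin 4,
    wsum (colH (coDressKBmAt (toSite r) (m + 1) (KInvStep (d := 3) (m + 1) 0)) (m + 1) μ y κ')
      (fun u => wsum (colH (coDressKBmAt (toSite r) (m + 1) (KInvStep (d := 3) (m + 1) 0)) (m + 1) ν y' κ'') (S₂ κ' u κ'')) x z c b

/-- [our object] **THE N-SIDE SECOND FAMILY OF PART 4**: `W2N s μ y ν y′ := twistR (W2lit s μ y ν y′) + embFF (cofPair s (m+1) a (colH G₀ (m+1) μ y) (colH G₀ (m+1) ν y′))`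
— PART 4's `𝒲N k := W2N m a r S₂ ((m+1)·p k)`. A definition; asserts nothing. -/
def W2N (s : ℕ) (μ : Fin 4) (y : Fin 4 → ℤ) (ν : Fin 4) (y' : Fin 4 → ℤ) : MKer 4 (Fib 3) :=
  twistR (W2lit m r S₂ s μ y ν y')
    + embFF (cofPair s (m + 1) a (colH (coDressKBmAt (toSite r) (m + 1) (KInvStep (d := 3) (m + 1) 0)) (m + 1) μ y)
        (colH (coDressKBmAt (toSite r) (m + 1) (KInvStep (d := 3) (m + 1) 0)) (m + 1) ν y'))

/-- [our object] **ITS LIMIT** `W2NInf μ y ν y′ := twistR (W2litInf μ y ν y′) + embFF (cofPairInf (m+1) a (colH G₀ (m+1) μ y) (colH G₀ (m+1) ν y′))` — PART 4's `𝒲N∞`. -/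
def W2NInf (μ : Fin 4) (y : Fin 4 → ℤ) (ν : Fin 4) (y' : Fin 4 → ℤ) : MKer 4 (Fib 3) :=
  twistR (W2litInf m r S₂ μ y ν y')
    + embFF (cofPairInf (m + 1) a (colH (coDressKBmAt (toSite r) (m + 1) (KInvStep (d := 3) (m + 1) 0)) (m + 1) μ y)
        (colH (coDressKBmAt (toSite r) (m + 1) (KInvStep (d := 3) (m + 1) 0)) (m + 1) ν y'))

/-- [folklore] Additivity of `kkt` in its first argument: `kkt (k + B) q = kkt k q + fromBlocks B 0 0 0`. -/
theorem kkt_add_eq {ν' μ' : Type*} (k B : Matrix ν' ν' ℝ) (q : Matrix μ' ν' ℝ) :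
    kkt (k + B) q = kkt k q + Matrix.fromBlocks B 0 0 0 := by
  rw [kkt, kkt, Matrix.fromBlocks_add]
  simp only [add_zero]

end Family

/-! ## §2 The second-order (A2-N) letter `hJN″` per torus -/

section Letter

variable (m : ℕ) {a : ℝ} (p : ℕ) [NeZero p] {r : Fin (3 + 1) → ℕ}

/-- [folklore] **«N-DICT» SECOND ORDER — THE (A2-N) LETTER `hJN″` OF PART 4 AT THE EXPLICIT FAMILY `W2N`.**  On the torus
`Site 4 ((m+1)·p)`, for a pair-stencil family `S₂` with the literal's structural sockets (`LocStencil₂`-type body, no mm block, fm∕mf ANTI-relation —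
PART 4's `hS₂ hS₂mm hS₂fm`), the co-frame data PINNED to TB4-W's jets packed by the responses at the coarse bonds `(μ,0)`, `(ν,z)` (`hT• hA•`, `hrS hrT`),
and the form blocks `kₛₜ qₛₜ` PINNED to the sorted periodised array of the literal's packed second table (`hkₛₜ hqₛₜ`):
`kkt (kₛₜ + tgramMix T₀ Tₛ Tₜ Tₛₜ A₀ Aₛ Aₜ Aₛₜ) qₛₜ = blocksHat p (sortK (m+1) (arr ((m+1)·p) (W2N m a r S₂ ((m+1)·p) μ 0 ν z)))`. -/
theorem kkt_packed_eq_blocksHat_W2N (ha : 0 < a) (hr : r ∈ box (3 + 1) (m + 1))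
    (S₂ : Fin 4 → (Fin 4 → ℤ) → Fin 4 → (Fin 4 → ℤ) → MKer 4 (Fib 3)) {Ck δ₂ : ℝ}
    (hS₂ : ∀ κ u κ' u', BiLoc (S₂ κ u κ' u') u u (Ck * Real.exp (-δ₂ * l1 (u' - u))) δ₂) (hδ₂ : 0 < δ₂)
    (hS₂mm : ∀ κ u κ' u' x y (c b : Fin 4), S₂ κ u κ' u' x y (Sum.inr c) (Sum.inr b) = 0)
    (hS₂fm : ∀ κ u κ' u' x y (c b : Fin 4), S₂ κ u κ' u' x y (Sum.inl c) (Sum.inr b) = -S₂ κ u κ' u' y x (Sum.inr b) (Sum.inl c))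
    (μ ν : Fin 4) (z : Fin 4 → ℤ) (rS rT : I 3 (m + 1) p → ℝ)
    (hrS : ∀ i, rS i = (kkt (Khat (d := 3) (m + 1) p) (Matrix.fromRows (Qhat (d := 3) (m + 1) p) (tauT (toSite r) (m + 1) p)))⁻¹
      (Sum.inl i) (Sum.inr (Sum.inl (siteOf 4 p 0, μ))))
    (hrT : ∀ i, rT i = (kkt (Khat (d := 3) (m + 1) p) (Matrix.fromRows (Qhat (d := 3) (m + 1) p) (tauT (toSite r) (m + 1) p)))⁻¹
      (Sum.inl i) (Sum.inr (Sum.inl (siteOf 4 p z, ν))))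
    (T₀ Tₛ Tₜ Tₛₜ : Matrix (CombRows (toSite r) (m + 1) p) (I 3 (m + 1) p) ℝ)
    (A₀ Aₛ Aₜ Aₛₜ : Matrix (CombRows (toSite r) (m + 1) p) (CombRows (toSite r) (m + 1) p) ℝ)
    (hT₀ : T₀ = Tjet₀ ((m + 1) * p) (Nhat r (m + 1) p) (e₁ (m + 1) p))
    (hTₛ : Tₛ = ∑ i : I 3 (m + 1) p, rS i • Tjet₁ ((m + 1) * p) (e₁ (m + 1) p i) (Nhat r (m + 1) p) (e₁ (m + 1) p))
    (hTₜ : Tₜ = ∑ i : I 3 (m + 1) p, rT i • Tjet₁ ((m + 1) * p) (e₁ (m + 1) p i) (Nhat r (m + 1) p) (e₁ (m + 1) p))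
    (hTₛₜ : Tₛₜ = ∑ i : I 3 (m + 1) p, ∑ j : I 3 (m + 1) p, (rS i * rT j) •
      Tjet₁₁ ((m + 1) * p) (e₁ (m + 1) p i) (e₁ (m + 1) p j) (Nhat r (m + 1) p) (e₁ (m + 1) p))
    (hA₀ : A₀ = Ajet₀ ((m + 1) * p) (Nhat r (m + 1) p))
    (hAₛ : Aₛ = ∑ i : I 3 (m + 1) p, rS i • Ajet₁ ((m + 1) * p) (e₁ (m + 1) p i) (Nhat r (m + 1) p))
    (hAₜ : Aₜ = ∑ i : I 3 (m + 1) p, rT i • Ajet₁ ((m + 1) * p) (e₁ (m + 1) p i) (Nhat r (m + 1) p))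
    (hAₛₜ : Aₛₜ = ∑ i : I 3 (m + 1) p, ∑ j : I 3 (m + 1) p, (rS i * rT j) •
      Ajet₁₁ ((m + 1) * p) (e₁ (m + 1) p i) (e₁ (m + 1) p j) (Nhat r (m + 1) p))
    (kₛₜ : Matrix (I 3 (m + 1) p) (I 3 (m + 1) p) ℝ) (qₛₜ : Matrix (J 3 p) (I 3 (m + 1) p) ℝ)
    (hkₛₜ : kₛₜ = Matrix.of (periodiseF p (fTL (sortK (m + 1) (arr ((m + 1) * p) (W2lit m r S₂ ((m + 1) * p) μ 0 ν z))))))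
    (hqₛₜ : qₛₜ = Matrix.of (periodiseF p (fBL (sortK (m + 1) (arr ((m + 1) * p) (W2lit m r S₂ ((m + 1) * p) μ 0 ν z)))))) :
    kkt (kₛₜ + tgramMix T₀ Tₛ Tₜ Tₛₜ A₀ Aₛ Aₜ Aₛₜ) qₛₜ
      = blocksHat p (sortK (m + 1) (arr ((m + 1) * p) (W2N m a r S₂ ((m + 1) * p) μ 0 ν z))) := by
  -- the road's resolvent and a common rate below `δ₂`, `δG` and `dB/8`
  obtain ⟨δG, CG, hδG, hCG, hG⟩ := decays_coDressKBmAt_KInvStep (d := 3) hr 0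
  have hd := dB_pos (m + 1) a ha
  set δ₀ : ℝ := min (min δ₂ δG) (dB (m + 1) a / 8) with hδ₀
  have hδ₀pos : 0 < δ₀ := lt_min (lt_min hδ₂ hδG) (by linarith)
  have hδ₀2 : δ₀ ≤ δ₂ := (min_le_left _ _).trans (min_le_left _ _)
  have hδ₀G : δ₀ ≤ δG := (min_le_left _ _).trans (min_le_right _ _)
  have hδ₀B : δ₀ ≤ dB (m + 1) a / 8 := min_le_right _ _
  have hCk : 0 ≤ Ck := by
    have h := (hS₂ 0 0 0 0).nonneg (Sum.inl 0)
    rwa [sub_self, l1_zero, mul_zero, Real.exp_zero, mul_one] at h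
  have hS₂' : ∀ κ u κ' u', BiLoc (S₂ κ u κ' u') u u (Ck * Real.exp (-δ₀ * l1 (u' - u))) δ₀ := fun κ u κ' u' x y c b =>
    (hS₂ κ u κ' u' x y c b).trans (mul_le_mul (mul_le_mul_of_nonneg_left (Real.exp_le_exp.mpr (by nlinarith [l1_nonneg (u' - u)])) hCk)
      (Real.exp_le_exp.mpr (by nlinarith [l1_nonneg (x - u), l1_nonneg (y - u)])) (Real.exp_pos _).le
      (mul_nonneg hCk (Real.exp_pos _).le))
  -- the packing weights and the response letters (PART 1c)
  have hwS : ∀ κ' u, |colH (coDressKBmAt (toSite r) (m + 1) (KInvStep (d := 3) (m + 1) 0)) (m + 1) μ 0 κ' u|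
      ≤ CG * Real.exp (-δ₀ * l1 (u - ((m + 1 : ℕ) : ℤ) • (0 : Fin 4 → ℤ))) := fun κ' => colH_weight hG hCG hδ₀G μ 0 κ'
  have hwT : ∀ κ' u, |colH (coDressKBmAt (toSite r) (m + 1) (KInvStep (d := 3) (m + 1) 0)) (m + 1) ν z κ' u|
      ≤ CG * Real.exp (-δ₀ * l1 (u - ((m + 1 : ℕ) : ℤ) • z)) := fun κ' => colH_weight hG hCG hδ₀G ν z κ'
  have hrS' : ∀ i, rS i = ∑' t : Fin 4 → ℤ, colH (coDressKBmAt (toSite r) (m + 1) (KInvStep (d := 3) (m + 1) 0)) (m + 1) μ 0 i.2.2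
      (imageShift ((m + 1) * p) (windowMap 4 ((m + 1) * p) (torusBlockEquiv (m + 1) p (i.1, i.2.1))) t) := fun i => by
    rw [hrS i]; exact response_siteOf_eq_tsum_colH hr p 0 μ i
  have hrT' : ∀ i, rT i = ∑' t : Fin 4 → ℤ, colH (coDressKBmAt (toSite r) (m + 1) (KInvStep (d := 3) (m + 1) 0)) (m + 1) ν z i.2.2
      (imageShift ((m + 1) * p) (windowMap 4 ((m + 1) * p) (torusBlockEquiv (m + 1) p (i.1, i.2.1))) t) := fun i => by
    rw [hrT i]; exact response_siteOf_eq_tsum_colH hr p z ν i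
  -- the two bi-localised summands of `W2N`
  have hL : BiLoc (W2lit m r S₂ ((m + 1) * p) μ 0 ν z) (((m + 1 : ℕ) : ℤ) • (0 : Fin 4 → ℤ)) (((m + 1 : ℕ) : ℤ) • (0 : Fin 4 → ℤ)) _ (δ₀ / 2) :=
    biLoc_sliceSum_images_colH (n := m + 1) hG hCG hS₂' hδ₀pos hδ₀G ((m + 1) * p) μ ν 0 z
  obtain ⟨CN, δN, -, hδN, hW⟩ := biLoc_cofPair_uniform m ha hwS hwT hδ₀pos hδ₀B
  -- the literal half: `kkt kₛₜ qₛₜ = blocksHat (sortK (arr (twistR W2lit)))`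
  have hlit : kkt kₛₜ qₛₜ = blocksHat p (sortK (m + 1) (arr ((m + 1) * p) (twistR (W2lit m r S₂ ((m + 1) * p) μ 0 ν z)))) := by
    rw [hkₛₜ, hqₛₜ, arr_twistR, blocksHat_sortK_twistR]
    exact (mul_sgn_eq_iff _ _).mp (packed_second_kkt_sgn p hS₂mm hS₂fm).symm
  -- assemble
  rw [kkt_add_eq, hlit, hT₀, hTₛ, hTₜ, hTₛₜ, hA₀, hAₛ, hAₜ, hAₛₜ, tgramMix_packed_eq_blocksHat m p ha hr hwS hwT hδ₀pos hδ₀B hrS' hrT', W2N,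
    blocksHat_sortK_arr_add (m + 1) p (biLoc_twistR _ hL) (half_pos hδ₀pos) (biLoc_embFF _ (hW p)) hδN]

end Letter

/-! ## §3 The sockets `hWN`, `hδWN`, `hlimWN` (at arbitrary base sites) and `hWNloc` -/

section Sockets

variable (m : ℕ) {a : ℝ} {r : Fin (3 + 1) → ℕ}

/-- [folklore] **(u1) FOR `W2N` — PART 4's `hWN`∕`hδWN`** (there `y := 0`): one constant and one rate for every torus of the road's family:
`∃ CN δN, 0 ≤ CN ∧ 0 < δN ∧ ∀ p, BiLoc (W2N m a r S₂ ((m+1)·p) μ y ν z) ((m+1)•y) ((m+1)•z) CN δN`. -/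
theorem biLoc_W2N_uniform (ha : 0 < a) (hr : r ∈ box (3 + 1) (m + 1))
    (S₂ : Fin 4 → (Fin 4 → ℤ) → Fin 4 → (Fin 4 → ℤ) → MKer 4 (Fib 3)) {Ck δ₂ : ℝ}
    (hS₂ : ∀ κ u κ' u', BiLoc (S₂ κ u κ' u') u u (Ck * Real.exp (-δ₂ * l1 (u' - u))) δ₂) (hδ₂ : 0 < δ₂)
    (μ : Fin 4) (y : Fin 4 → ℤ) (ν : Fin 4) (z : Fin 4 → ℤ) :
    ∃ CN δN : ℝ, 0 ≤ CN ∧ 0 < δN ∧ ∀ (p : ℕ) [NeZero p],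
      BiLoc (W2N m a r S₂ ((m + 1) * p) μ y ν z) (((m + 1 : ℕ) : ℤ) • y) (((m + 1 : ℕ) : ℤ) • z) CN δN := by
  obtain ⟨δG, CG, hδG, hCG, hG⟩ := decays_coDressKBmAt_KInvStep (d := 3) hr 0
  have hd := dB_pos (m + 1) a ha
  set δ₀ : ℝ := min (min δ₂ δG) (dB (m + 1) a / 8) with hδ₀
  have hδ₀pos : 0 < δ₀ := lt_min (lt_min hδ₂ hδG) (by linarith)
  have hδ₀2 : δ₀ ≤ δ₂ := (min_le_left _ _).trans (min_le_left _ _)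
  have hδ₀G : δ₀ ≤ δG := (min_le_left _ _).trans (min_le_right _ _)
  have hδ₀B : δ₀ ≤ dB (m + 1) a / 8 := min_le_right _ _
  have hCk : 0 ≤ Ck := by
    have h := (hS₂ 0 0 0 0).nonneg (Sum.inl 0)
    rwa [sub_self, l1_zero, mul_zero, Real.exp_zero, mul_one] at h
  have hS₂' : ∀ κ u κ' u', BiLoc (S₂ κ u κ' u') u u (Ck * Real.exp (-δ₀ * l1 (u' - u))) δ₀ := fun κ u κ' u' x y c b =>
    (hS₂ κ u κ' u' x y c b).trans (mul_le_mul (mul_le_mul_of_nonneg_left (Real.exp_le_exp.mpr (by nlinarith [l1_nonneg (u' - u)])) hCk)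
      (Real.exp_le_exp.mpr (by nlinarith [l1_nonneg (x - u), l1_nonneg (y - u)])) (Real.exp_pos _).le
      (mul_nonneg hCk (Real.exp_pos _).le))
  have hwS : ∀ κ' u, |colH (coDressKBmAt (toSite r) (m + 1) (KInvStep (d := 3) (m + 1) 0)) (m + 1) μ y κ' u|
      ≤ CG * Real.exp (-δ₀ * l1 (u - ((m + 1 : ℕ) : ℤ) • y)) := fun κ' => colH_weight hG hCG hδ₀G μ y κ'
  have hwT : ∀ κ' u, |colH (coDressKBmAt (toSite r) (m + 1) (KInvStep (d := 3) (m + 1) 0)) (m + 1) ν z κ' u|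
      ≤ CG * Real.exp (-δ₀ * l1 (u - ((m + 1 : ℕ) : ℤ) • z)) := fun κ' => colH_weight hG hCG hδ₀G ν z κ'
  obtain ⟨CN, δN, hCN, hδN, hW⟩ := biLoc_cofPair_uniform m ha hwS hwT hδ₀pos hδ₀B
  have hL : ∀ (p : ℕ) [NeZero p], BiLoc (W2lit m r S₂ ((m + 1) * p) μ y ν z) (((m + 1 : ℕ) : ℤ) • y) (((m + 1 : ℕ) : ℤ) • z)
      _ (δ₀ / 2) := fun p _ =>
    biLoc_recentre (biLoc_sliceSum_images_colH (n := m + 1) hG hCG hS₂' hδ₀pos hδ₀G ((m + 1) * p) μ ν y z) (half_pos hδ₀pos).le _ _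
  refine ⟨_, min (δ₀ / 2) δN, ?_, lt_min (half_pos hδ₀pos) hδN, fun p _ =>
    biLoc_add (StepJetData.biLoc_weaken (biLoc_twistR _ (hL p)) le_rfl (min_le_left _ _))
      (StepJetData.biLoc_weaken (biLoc_embFF _ (hW p)) le_rfl (min_le_right _ _))⟩
  exact add_nonneg ((hL 1).nonneg (Sum.inl 0)) hCN

/-- [folklore] **(u2) FOR `W2N` — PART 4's `hlimWN`** (there `y := 0`): along `p k → ∞`, `W2N m a r S₂ ((m+1)·p k) μ y ν z → W2NInf m a r S₂ μ y ν z`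
entrywise. -/
theorem tendsto_W2N (ha : 0 < a) (hr : r ∈ box (3 + 1) (m + 1))
    (S₂ : Fin 4 → (Fin 4 → ℤ) → Fin 4 → (Fin 4 → ℤ) → MKer 4 (Fib 3)) {Ck δ₂ : ℝ}
    (hS₂ : ∀ κ u κ' u', BiLoc (S₂ κ u κ' u') u u (Ck * Real.exp (-δ₂ * l1 (u' - u))) δ₂) (hδ₂ : 0 < δ₂)
    (μ : Fin 4) (y : Fin 4 → ℤ) (ν : Fin 4) (z : Fin 4 → ℤ) {p : ℕ → ℕ} [∀ k, NeZero (p k)] (hp : Tendsto p atTop atTop)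
    (x x' : Fin 4 → ℤ) (c b : Fib 3) :
    Tendsto (fun k => W2N m a r S₂ ((m + 1) * p k) μ y ν z x x' c b) atTop (𝓝 (W2NInf m a r S₂ μ y ν z x x' c b)) := by
  obtain ⟨δG, CG, hδG, hCG, hG⟩ := decays_coDressKBmAt_KInvStep (d := 3) hr 0
  have hd := dB_pos (m + 1) a ha
  set δ₀ : ℝ := min (min δ₂ δG) (dB (m + 1) a / 8) with hδ₀
  have hδ₀pos : 0 < δ₀ := lt_min (lt_min hδ₂ hδG) (by linarith)
  have hδ₀2 : δ₀ ≤ δ₂ := (min_le_left _ _).trans (min_le_left _ _)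
  have hδ₀G : δ₀ ≤ δG := (min_le_left _ _).trans (min_le_right _ _)
  have hδ₀B : δ₀ ≤ dB (m + 1) a / 8 := min_le_right _ _
  have hCk : 0 ≤ Ck := by
    have h := (hS₂ 0 0 0 0).nonneg (Sum.inl 0)
    rwa [sub_self, l1_zero, mul_zero, Real.exp_zero, mul_one] at h
  have hS₂' : ∀ κ u κ' u', BiLoc (S₂ κ u κ' u') u u (Ck * Real.exp (-δ₀ * l1 (u' - u))) δ₀ := fun κ u κ' u' x y c b =>
    (hS₂ κ u κ' u' x y c b).trans (mul_le_mul (mul_le_mul_of_nonneg_left (Real.exp_le_exp.mpr (by nlinarith [l1_nonneg (u' - u)])) hCk)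
      (Real.exp_le_exp.mpr (by nlinarith [l1_nonneg (x - u), l1_nonneg (y - u)])) (Real.exp_pos _).le
      (mul_nonneg hCk (Real.exp_pos _).le))
  have hwS : ∀ κ' u, |colH (coDressKBmAt (toSite r) (m + 1) (KInvStep (d := 3) (m + 1) 0)) (m + 1) μ y κ' u|
      ≤ CG * Real.exp (-δ₀ * l1 (u - ((m + 1 : ℕ) : ℤ) • y)) := fun κ' => colH_weight hG hCG hδ₀G μ y κ'
  have hwT : ∀ κ' u, |colH (coDressKBmAt (toSite r) (m + 1) (KInvStep (d := 3) (m + 1) 0)) (m + 1) ν z κ' u|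
      ≤ CG * Real.exp (-δ₀ * l1 (u - ((m + 1 : ℕ) : ℤ) • z)) := fun κ' => colH_weight hG hCG hδ₀G ν z κ'
  have Tlit : Tendsto (fun k => W2lit m r S₂ ((m + 1) * p k) μ y ν z x x' c b) atTop (𝓝 (W2litInf m r S₂ μ y ν z x x' c b)) :=
    (tendsto_sliceSum_images_colH (n := m + 1) hG hCG hS₂' hδ₀pos hδ₀G μ ν y z x x' c b).comp
      (TorusWeightMixedLimit.tendsto_sigma m p hp)
  have Tcof : Tendsto (fun k => embFF (cofPair ((m + 1) * p k) (m + 1) a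
        (colH (coDressKBmAt (toSite r) (m + 1) (KInvStep (d := 3) (m + 1) 0)) (m + 1) μ y)
        (colH (coDressKBmAt (toSite r) (m + 1) (KInvStep (d := 3) (m + 1) 0)) (m + 1) ν z)) x x' c b) atTop
      (𝓝 (embFF (cofPairInf (m + 1) a (colH (coDressKBmAt (toSite r) (m + 1) (KInvStep (d := 3) (m + 1) 0)) (m + 1) μ y)
        (colH (coDressKBmAt (toSite r) (m + 1) (KInvStep (d := 3) (m + 1) 0)) (m + 1) ν z)) x x' c b)) := by
    rcases c with γ | γ <;> rcases b with β | β
    · simp only [embFF_inl_inl]; exact tendsto_cofPair m p ha hwS hwT hδ₀pos hδ₀B hp x x' γ β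
    · simp only [embFF_inl_inr]; exact tendsto_const_nhds
    · simp only [embFF_inr_inl]; exact tendsto_const_nhds
    · simp only [embFF_inr_inr]; exact tendsto_const_nhds
  simp only [W2N, W2NInf, Pi.add_apply]
  exact (tendsto_twistR_apply x x' c b Tlit).add Tcof

/-- [folklore] **THE `Loc` LETTER OF THE LIMIT FAMILY — PART 8's `hWNloc`**: `Loc (W2NInf m a r S₂ μ y ν z)` at every pair of base points
(the k-uniform bound of `biLoc_W2N_uniform` is a closed condition along the entrywise limit `tendsto_W2N` with `p k := k + 1`). -/
theorem loc_W2NInf (ha : 0 < a) (hr : r ∈ box (3 + 1) (m + 1))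
    (S₂ : Fin 4 → (Fin 4 → ℤ) → Fin 4 → (Fin 4 → ℤ) → MKer 4 (Fib 3)) {Ck δ₂ : ℝ}
    (hS₂ : ∀ κ u κ' u', BiLoc (S₂ κ u κ' u') u u (Ck * Real.exp (-δ₂ * l1 (u' - u))) δ₂) (hδ₂ : 0 < δ₂)
    (μ : Fin 4) (y : Fin 4 → ℤ) (ν : Fin 4) (z : Fin 4 → ℤ) :
    TameKernelCalculus.Loc (W2NInf m a r S₂ μ y ν z) := by
  obtain ⟨CN, δN, -, hδN, hW⟩ := biLoc_W2N_uniform m ha hr S₂ hS₂ hδ₂ μ y ν z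
  exact ⟨_, _, CN, δN, hδN, fun x x' c b =>
    le_of_tendsto' ((tendsto_W2N m ha hr S₂ hS₂ hδ₂ μ y ν z (p := fun k => k + 1) (tendsto_add_atTop_nat 1) x x' c b).abs)
      fun k => hW (k + 1) x x' c b⟩

end Sockets

end Summit.QuantumFields.BalabanUV.Beta.D1BFx.PackedNSidePair

end
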